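import Summits.BirchSwinnertonDyer.Rank1Residual.X12.JZeroSecondKernelRecords
import Summits.BirchSwinnertonDyer.Rank1Residual.X12.JZeroThreeDescent
import HarnessLib

/-!
# K12r@3, the `3`-DIVISIBLE regime: classes `309123c`, `309123d` (`#Ш_an = 9` on `c1`, `c3`, `d1`) —
# the `3`-isogenies BY NAME, `BSD(·, 3)` in the cell's booking shape, and `#Ш[3^∞] = 9 = 3²` EXACTLY
# with `Ш[3^∞] = Ш[3] ≅ (ℤ/3ℤ)²` on `309123c1` and `309123d1` (cell `bsd-print-cfram`, seat p4)

HONEST FRAMING (cell `bsd-print-cfram`, run/shared/lean/pub/bsd-print-cfram/, D-0131 (2) print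
tier; verbatim in every file of the seat): the cell works the partition leaf
`CornerF ∧ p ramified in the CM field K` (LADDER-BSD row K7r = B13; W-ALL row 12r) in PARTITION
currency — a leaf or a cell counts only when its theorem is in the kernel BY NAME. NO class-wide
theorem for the `p = 3` slice is in print (bsd-wall-cm K12R3-SCOPING-v1 §3); this file holds
PER-CLASS records, in the booking shape of `X12/JZeroThreeDescent.lean`
(`JZeroThree.bsdp_three_of_noThreeTorsion`, seam `X12.bsdp_of_sha_torsion_eq_zero` p220351), for the
ONLY two classes of the range `N < 5·10⁵` with `3 ∣ #Ш_an` — the route tribunal's «first rung beyond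
print: 309123c/d (#Ш_an = 9)» — COMPLETING the b2b-bsdres records of
`X12/JZeroSecondKernelRecords.lean` (x1b gen 26/45, p403480: models, `Sel^{(3)}`-shape records,
`IsIsogenous` taken as a binder, the exact order `9` stated «on paper» only). New here: (i) the two
`3`-isogenies `c1 ~ c2`, `d1 ~ d2` PROVED (tree `X12CubeSum.isIsogenous_of_a₆`), discharging that
binder; (ii) the records in this cell's `Ш[3] = 0` shape with the leaf cells `cornerF_three_…`;
(iii) the KERNEL theorems `#Ш(309123c1)[3^∞] = 9`, `#Ш(309123d1)[3^∞] = 9` (generic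
`card_primaryComponent_eq_pow_of_bsdp`: `BSD(E,p)` + `#Ш_an = q` ⟹ `#Ш[p^∞] = p^{ord_p q}`) and the
structure `Ш[3^∞] = Ш[3]` under one more displayed certificate binder `h9`. Definitions reused
(Cremona's minimal models `Records.c309123c1/c2/d1/d2` of p403480); theorems only; no named fact;
nothing about any curve is ASSERTED — the per-curve inputs are hypotheses (`hr`, `h0`/`hSel`,
`hq`/`hv`, `h9`). beyond-print: NO (certificate assembly; first descent by a `3`-isogeny,
Cassels–Tate on a `3`-isogeny Selmer group and second `φ`-descent are printed METHODS —
Schaefer–Stoll 2004, van Beek–Fisher 2018, Creutz–Miller 2012 — the instances are not in print).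

THE CLASSES (`N = 309123 = 3³·107²`, Cremona; all members rank `1`, trivial torsion).
`309123c`: `c1 = [0,0,1,0,−306261]` (`j = 0`, `#Ш_an = 9`, `∏c = 2`), `c2 = [0,0,1,0,8269040]`
(`j = 0`, `#Ш_an = 1`, `∏c = 6`), `c3`, `c4 = [0,0,1,−3091230,2092067183]` (`j = −12288000`,
`#Ш_an = 9, 1`); rational `3`-isogeny graph `c1 —⟨x=0⟩— c2`, `c1 —⟨x=107⟩— c3`, `c2 —⟨x=−321⟩— c4`.
`309123d`: `d1 = [0,0,1,0,−3506379327]` (`#Ш_an = 9`, `∏c = 1`), `d2 = [0,0,1,0,94672241822]`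
(`#Ш_an = 1`, `∏c = 3`), ONE kernel each (the `j = 0` edge). On both `j = 0` edges the first
descent is NOT sharp: `(s_φ, s_φ̂, m, EXCESS) = (2, 1, 1, 2)` at `c1` and at `d1`.

THE CERTIFICATES behind `h0` (all kit jobs attached to item stmt-BirchSwinnertonDyer-20371).
* `309123c2`: FIRST descent along the OTHER edge `φ : c2 → c4` (kernel `x = −321` over `ℚ(√−107)`,
  dual `x = 963` over `ℚ(√321)`): `(dim Sel^φ̂(c4), dim Sel^φ(c2), m, EXCESS) = (1, 0, 1, 0)`, so
  `Ш(c2)[φ] = 0 = Ш(c4)[φ̂]` and `Ш(c2)[3] = 0` (`0 → Ш(c2)[φ] → Ш(c2)[3] → Ш(c4)[φ̂]`, `φ̂φ = [3]`).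
  Two engines of different METHOD run by this seat: K = sha-2 `iso3kum.gp` (sha256 a8402cb1…,
  general-kernel mode: Kummer images of the flex tangent `L_T` in `ℚ(√d)(S,3)`, `bnfcertify = 1`,
  local images to Schaefer's exact size) kit **j282241**; C = sha-2 `isogcft.gp` (sha256 0e36e3a0…:
  `Sel^φ ⊂ Hom(Cl_𝔪(ℚ(T))/3, 𝔽₃)^χ` by Artin reciprocity, fibre polynomials + local norm groups,
  `bnfcertify = 1`, Poitou–Tate identity PASS both sides) kit **j282242** — agreeing, also on the
  dual edge `(0, 1, 1, 0)`, on every edge of the validation classes `14283i` (the `N = 3³·23²` twin of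
  `309123c`), `576a`, `1728v` (EXCESS `0`), and on the `j = 0` edges (EXCESS `2`); and earlier by two
  OTHER seats (b2b cc-eng-5 K + F; x1b `desc3q.gp`, p403480's docstring): four code bases.
* `309123d2`: the Cassels–Tate form on `Sel^φ(d1/ℚ) = Ш(d1)[φ] ≅ 𝔽₃²` is NON-DEGENERATE, so no
  class of `Ш(d1)[φ]` is divisible by `φ̂` in `Ш`, `φ_*Ш(d2)[3] = 0`, and with `Ш(d2)[φ] = 0` (exact
  first descent): `Ш(d2)[3] = 0`, `#Sel^{(3)}(d2) = 3`. b2b instrument B-24 `I-O6-CTP3ISO`, two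
  implementations of different METHOD, pre-registered criterion P-x1b-g45-1 MET (b2b
  `class-closure/O11/OFFER-309123d-x1b.md`): `ctp3iso` 0.2.2 (Cassels–Tate via van Beek–Fisher
  lifts; CT matrix `[[0,1],[2,0]]`, rank `2`, kernel `0`, EXACT, `bnfcertify` 1, controls 10/10) kit
  j259505, and `phisel3` (Creutz–Miller second `φ`-descent: the 4 non-Mordell–Weil cubic lines
  `t³+6t−17`, `t³−t²−3t−2`, `t³+15t−28`, `t³+18t−45` have EMPTY `3`-coverings, `bnfcertify` 1,
  EXACT) kit j243149; both RE-PRESSED byte-identically by this seat (kit j282602 / j282605).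
* `h9` (structure theorems): `dim_𝔽₃ Ш(c1)[φ] = EXCESS(c1 — c2) − dim Ш(c2)[φ̂] = 2 − 0` and the
  same at `d1` — so `Ш(·1)[3] ⊇ (ℤ/3)²` — from the same runs.

References: `X12/JZeroSecondKernelRecords.lean`; `X12/JZeroThreeDescent.lean`; [cite: Cremona1997, Table 1];
[cite: Miller2011LMS, §1 and Def. 1.1]; [cite: MilneADT2006, Thm. I.7.3]; [cite: SilvermanAEC2009, X.4];
[cite: SchaeferStoll2004, §3]; [cite: CreutzMiller2012, Lemma 2.3, Rem. 2.4]; [cite: vanBeekFisher2018, §2].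
-/

set_option autoImplicit false

noncomputable section

open scoped Classical

open WeierstrassCurve Literature.NumberTheory.EllipticCurves
  Literature.NumberTheory.EllipticCurves.ModularForms
  Literature.NumberTheory.EllipticCurves.Rank1Residual
  Literature.NumberTheory.EllipticCurves.Rank1Residual.Typed

namespace Summit.BirchSwinnertonDyer.Rank1Residual.X12

/-! ## §1 The `3`-isogenies by name and the leaf cells -/

namespace Records

/-- **`309123c1 ~ 309123c2` over `ℚ`**: Vélu's `3`-isogeny `E_k → E_{−27k}`, kernel `⟨(0, ±√k)⟩`,
`k = 64·(−306261) + 16 = −19600688`, `64·8269040 + 16 = 529218576 = −27k` (tree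
`X12CubeSum.isIsogenous_of_a₆`) — discharging the class-sentence binder of p403480's
`X12.bsdp_three_c309123c1`. [cite: SilvermanAEC2009, III.4 Remark 4.13.3 (Vélu)] [cite: Cremona1997, Table 1 (class 309123c)] -/
theorem isIsogenous_c309123c1_c2 : IsIsogenous c309123c1 c309123c2 :=
  X12CubeSum.isIsogenous_of_a₆ (by norm_num) (by norm_num)

/-- **`309123d1 ~ 309123d2` over `ℚ`**: the same `3`-isogeny with `k = 64·(−3506379327) + 16 =
−224408276912`, `64·94672241822 + 16 = 6059023476624 = −27k` — discharging the class-sentence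
binder of p403480's `X12.bsdp_three_c309123d1`. [cite: SilvermanAEC2009, III.4 Remark 4.13.3 (Vélu)]
[cite: Cremona1997, Table 1 (class 309123d)] -/
theorem isIsogenous_c309123d1_d2 : IsIsogenous c309123d1 c309123d2 :=
  X12CubeSum.isIsogenous_of_a₆ (by norm_num) (by norm_num)

end Records

/-- **`(309123c1, 3)` is a cell of the leaf `CornerF ∧ CMRamified` at `3`** (CM by `ℚ(√−3)`,
`r_an = 1`, `3` bad and ramified), given `ord_{s=1} L(E,s) = 1` (`hr`; Cremona). [folklore] -/
theorem cornerF_three_c309123c1 (hr : Records.c309123c1.analyticRank = 1) :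
    CornerF Records.c309123c1 3 :=
  JZeroThree.cornerF_three_of_j_eq_zero _ Records.c309123c1_j hr

/-- **`(309123c2, 3)` is a cell of the leaf** at `3`, given `r_an = 1` (`hr`). [folklore] -/
theorem cornerF_three_c309123c2 (hr : Records.c309123c2.analyticRank = 1) :
    CornerF Records.c309123c2 3 :=
  JZeroThree.cornerF_three_of_j_eq_zero _ Records.c309123c2_j hr

/-- **`(309123d1, 3)` is a cell of the leaf** at `3`, given `r_an = 1` (`hr`). [folklore] -/
theorem cornerF_three_c309123d1 (hr : Records.c309123d1.analyticRank = 1) :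
    CornerF Records.c309123d1 3 :=
  JZeroThree.cornerF_three_of_j_eq_zero _ Records.c309123d1_j hr

/-- **`(309123d2, 3)` is a cell of the leaf** at `3`, given `r_an = 1` (`hr`). [folklore] -/
theorem cornerF_three_c309123d2 (hr : Records.c309123d2.analyticRank = 1) :
    CornerF Records.c309123d2 3 :=
  JZeroThree.cornerF_three_of_j_eq_zero _ Records.c309123d2_j hr

/-! ## §2 `BSD(·, 3)` on both classes: the cell's `Ш[3] = 0` shape, and p403480's `Sel₃` shape with the isogeny discharged -/

/-- **`BSD(309123c2, 3)` and `#Ш(309123c2/ℚ)[3^∞] = 1`** from GZK (`hGZK`), `ord_{s=1} L ≤ 1` (`hr`),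
the certificate `Ш(c2/ℚ)[3] = 0` (`h0`: edge `c2 → c4`, kernel `x = −321`, EXCESS `0` on engines
K kit j282241 and C kit j282242) and `#Ш_an = q`, `ord₃ q = 0` (`hq`, `hv`; Cremona `1`). The
`j = 0` edge `c2 — c1` alone does NOT certify `h0` (EXCESS `2`). PER CURVE; nothing asserted.
[cite: Miller2011LMS, §1 and Def. 1.1] [cite: Cremona1997, Table 1 (class 309123c)] -/
theorem bsdp_three_c309123c2_of_noThreeTorsion (hGZK : rank_eq_analyticRank_of_analyticRank_le_one)
    (hr : Records.c309123c2.analyticRank ≤ 1)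
    (h0 : ∀ x : ↥Records.c309123c2.sha, 3 • x = 0 → x = 0)
    {q : ℚ} (hq : shaAn Records.c309123c2 = (q : ℂ)) (hv : padicValRat 3 q = 0) :
    BSDp Records.c309123c2 3 ∧
      Nat.card (AddCommGroup.primaryComponent Records.c309123c2.sha 3) = 1 :=
  JZeroThree.bsdp_three_of_noThreeTorsion _ hGZK hr h0 hq hv

/-- **`BSD(309123c1, 3)`** (the `#Ш_an = 9` member) with `ord_{s=1} L(c1,s) = 1`, transported from
the certificate on `c2` along the PROVED isogeny `c1 ~ c2` (Cassels `hCassels`, modularity `hmod`,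
GZK; tree `JZeroThree.bsdp_three_of_isIsogenous_of_noThreeTorsion`). PER CLASS; nothing asserted.
[cite: MilneADT2006, Thm. I.7.3] [cite: Miller2011LMS, §1 and Def. 1.1] -/
theorem bsdp_three_c309123c1_of_noThreeTorsion (hGZK : rank_eq_analyticRank_of_analyticRank_le_one)
    (hmod : hasEntireLFunction_rat) (hCassels : bsdRHS_eq_of_isIsogenous)
    (hr : Records.c309123c2.analyticRank = 1)
    (h0 : ∀ x : ↥Records.c309123c2.sha, 3 • x = 0 → x = 0)
    {q : ℚ} (hq : shaAn Records.c309123c2 = (q : ℂ)) (hv : padicValRat 3 q = 0) :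
    Records.c309123c1.analyticRank = 1 ∧ BSDp Records.c309123c1 3 :=
  JZeroThree.bsdp_three_of_isIsogenous_of_noThreeTorsion hGZK hmod hCassels hr h0 hq hv
    Records.c309123c1 Records.isIsogenous_c309123c1_c2

/-- p403480's record `X12.bsdp_three_c309123c1` (`Sel₃`-shape certificate `#Sel^{(3)}(c2) ∣ 3`) with
its `IsIsogenous c1 c2` binder DISCHARGED by `Records.isIsogenous_c309123c1_c2`. PER CLASS.
[cite: MilneADT2006, Thm. I.7.3] [cite: Miller2011LMS, §1 and Def. 1.1] -/
theorem bsdp_three_c309123c1_of_selmer (hGZK : rank_eq_analyticRank_of_analyticRank_le_one)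
    (hmod : hasEntireLFunction_rat) (hCassels : bsdRHS_eq_of_isIsogenous)
    (hr : Records.c309123c2.analyticRank = 1)
    {q : ℚ} (hq : shaAn Records.c309123c2 = (q : ℂ)) (hv : padicValRat 3 q = 0)
    (hSel : Nat.card (Records.c309123c2.selmerGroup ((3 : ℕ) : ℤ)) ∣ 3) :
    BSDp Records.c309123c1 3 :=
  bsdp_three_c309123c1 hGZK hmod hCassels Records.isIsogenous_c309123c1_c2 hr hq hv hSel

/-- **`BSD(309123d2, 3)` and `#Ш(309123d2/ℚ)[3^∞] = 1`** from GZK, `ord_{s=1} L ≤ 1` (`hr`), the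
certificate `Ш(d2/ℚ)[3] = 0` (`h0`: Cassels–Tate on `Sel^φ(d1) = Ш(d1)[φ] ≅ 𝔽₃²` NON-DEGENERATE —
b2b B-24 `ctp3iso` kit j259505 ‖ second `φ`-descent `phisel3` kit j243149, AGREE, EXACT; re-pressed
by this seat kit j282602 / j282605) and `#Ш_an = q`, `ord₃ q = 0` (`hq`, `hv`; Cremona `1`). PER
CURVE; nothing asserted. [cite: Miller2011LMS, §1 and Def. 1.1] [cite: CreutzMiller2012, Lemma 2.3, Rem. 2.4]
[cite: Cremona1997, Table 1 (class 309123d)] -/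
theorem bsdp_three_c309123d2_of_noThreeTorsion (hGZK : rank_eq_analyticRank_of_analyticRank_le_one)
    (hr : Records.c309123d2.analyticRank ≤ 1)
    (h0 : ∀ x : ↥Records.c309123d2.sha, 3 • x = 0 → x = 0)
    {q : ℚ} (hq : shaAn Records.c309123d2 = (q : ℂ)) (hv : padicValRat 3 q = 0) :
    BSDp Records.c309123d2 3 ∧
      Nat.card (AddCommGroup.primaryComponent Records.c309123d2.sha 3) = 1 :=
  JZeroThree.bsdp_three_of_noThreeTorsion _ hGZK hr h0 hq hv

/-- **`BSD(309123d1, 3)`** (the `#Ш_an = 9` member) with `ord_{s=1} L(d1,s) = 1`, transported from the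
certificate on `d2` along the PROVED isogeny `d1 ~ d2`. PER CLASS; nothing asserted.
[cite: MilneADT2006, Thm. I.7.3] [cite: Miller2011LMS, §1 and Def. 1.1] -/
theorem bsdp_three_c309123d1_of_noThreeTorsion (hGZK : rank_eq_analyticRank_of_analyticRank_le_one)
    (hmod : hasEntireLFunction_rat) (hCassels : bsdRHS_eq_of_isIsogenous)
    (hr : Records.c309123d2.analyticRank = 1)
    (h0 : ∀ x : ↥Records.c309123d2.sha, 3 • x = 0 → x = 0)
    {q : ℚ} (hq : shaAn Records.c309123d2 = (q : ℂ)) (hv : padicValRat 3 q = 0) :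
    Records.c309123d1.analyticRank = 1 ∧ BSDp Records.c309123d1 3 :=
  JZeroThree.bsdp_three_of_isIsogenous_of_noThreeTorsion hGZK hmod hCassels hr h0 hq hv
    Records.c309123d1 Records.isIsogenous_c309123d1_d2

/-- p403480's record shape `X12.bsdp_three_c309123d1` (`Sel₃`-shape certificate `#Sel^{(3)}(d2) ∣ 3`,
= the B-24 verdict) with its `IsIsogenous d1 d2` binder DISCHARGED. PER CLASS.
[cite: MilneADT2006, Thm. I.7.3] [cite: Miller2011LMS, §1 and Def. 1.1] -/
theorem bsdp_three_c309123d1_of_selmer (hGZK : rank_eq_analyticRank_of_analyticRank_le_one)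
    (hmod : hasEntireLFunction_rat) (hCassels : bsdRHS_eq_of_isIsogenous)
    (hr : Records.c309123d2.analyticRank = 1)
    {q : ℚ} (hq : shaAn Records.c309123d2 = (q : ℂ)) (hv : padicValRat 3 q = 0)
    (hSel : Nat.card (Records.c309123d2.selmerGroup ((3 : ℕ) : ℤ)) ∣ 3) :
    BSDp Records.c309123d1 3 :=
  bsdp_three_c309123d1 hGZK hmod hCassels Records.isIsogenous_c309123d1_d2 hr hq hv hSel

/-! ## §3 The exact order and the structure of `Ш[3^∞]` on the `#Ш_an = 9` members -/

namespace JZeroThree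

/-- **`BSD(E, p)` pins the order of `Ш(E/ℚ)[p^∞]`.** If Miller's `BSD(E, p)` holds and
`#Ш(E/ℚ)_an = q` with `ord_p q = n`, then `#Ш(E/ℚ)[p^∞] = pⁿ`: `BSD(E,p)` makes `Ш[p^∞]` finite —
hence of `p`-power order (tree `exists_card_addPrimaryComponent_eq_pow`) — and equates
`ord_p #Ш[p^∞]` with `ord_p #Ш_an` (its rational witness is `q`, `ℚ → ℂ` being injective). Any
curve, any prime. [cite: Miller2011LMS, Def. 1.1 (arXiv:1010.2431 p. 3)] -/
theorem card_primaryComponent_eq_pow_of_bsdp (W : WeierstrassCurve ℚ) (p : ℕ) [Fact p.Prime]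
    (h : BSDp W p) {q : ℚ} (hq : shaAn W = (q : ℂ)) {n : ℕ} (hv : padicValRat p q = n) :
    Nat.card (AddCommGroup.primaryComponent W.sha p) = p ^ n := by
  obtain ⟨-, hfin, q', hq', hval⟩ := h
  have hqq : q' = q := by
    have : ((q' : ℚ) : ℂ) = ((q : ℚ) : ℂ) := hq'.symm.trans hq
    exact_mod_cast this
  subst hqq
  haveI := hfin
  obtain ⟨m, hm⟩ := exists_card_addPrimaryComponent_eq_pow (A := ↥W.sha) p
  rw [hm, padicValNat.prime_pow] at hval
  rw [hval] at hv
  have hmn : m = n := by exact_mod_cast hv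
  rw [hm, hmn]

/-- If the `p`-primary component of an additive commutative group is finite with at most as many
elements as the `p`-torsion `A[p]`, then it IS the `p`-torsion: every element of `A[p^∞]` is killed
by `p` (`A[p] ↪ A[p^∞]` is then onto, by counting). [folklore] -/
theorem primaryComponent_smul_eq_zero_of_card {A : Type*} [AddCommGroup A] (p : ℕ)
    [Finite (AddCommGroup.primaryComponent A p)]
    (hle : Nat.card (AddCommGroup.primaryComponent A p) ≤ Nat.card {x : A // p • x = 0}) :
    ∀ x : A, x ∈ AddCommGroup.primaryComponent A p → p • x = 0 := by
  let f : {x : A // p • x = 0} → ↥(AddCommGroup.primaryComponent A p) := fun x ↦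
    ⟨x.1, (AddCommGroup.mem_primaryComponent).mpr ⟨1, by simp [x.2]⟩⟩
  have hf : Function.Injective f := by
    intro a b hab
    exact Subtype.ext (by simpa [f] using congrArg Subtype.val hab)
  have hbij : Function.Bijective f := hf.bijective_of_nat_card_le hle
  intro x hx
  obtain ⟨y, hy⟩ := hbij.2 ⟨x, hx⟩
  have : (y.1 : A) = x := by simpa [f] using congrArg Subtype.val hy
  rw [← this]
  exact y.2

end JZeroThree

/-- **`#Ш(309123c1/ℚ)[3^∞] = 9` EXACTLY**: `BSD(c1, 3)` (`bsdp_three_c309123c1_of_noThreeTorsion`, from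
the two-engine first descent on `c2`) and `#Ш_an(c1) = q₁`, `ord₃ q₁ = 2` (`hq1`, `hv1`; Cremona /
ecdata `#Ш_an(309123c1) = 9`, the lane's analytic order of record) give `#Ш(c1)[3^∞] = 3²`. No printed
theorem gives this number (Kolyvagin / Kriz–Li need a `3`-unit Heegner index, which `#Ш_an = 9`
forbids). PER CLASS; nothing asserted. [cite: Miller2011LMS, §1 and Def. 1.1] [cite: Cremona1997, Table 1 (class 309123c)] -/
theorem card_sha_three_c309123c1 (hGZK : rank_eq_analyticRank_of_analyticRank_le_one)
    (hmod : hasEntireLFunction_rat) (hCassels : bsdRHS_eq_of_isIsogenous)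
    (hr : Records.c309123c2.analyticRank = 1)
    (h0 : ∀ x : ↥Records.c309123c2.sha, 3 • x = 0 → x = 0)
    {q : ℚ} (hq : shaAn Records.c309123c2 = (q : ℂ)) (hv : padicValRat 3 q = 0)
    {q₁ : ℚ} (hq1 : shaAn Records.c309123c1 = (q₁ : ℂ)) (hv1 : padicValRat 3 q₁ = 2) :
    Nat.card (AddCommGroup.primaryComponent Records.c309123c1.sha 3) = 9 := by
  haveI : Fact (Nat.Prime 3) := ⟨Nat.prime_three⟩
  have h := JZeroThree.card_primaryComponent_eq_pow_of_bsdp Records.c309123c1 3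
    (bsdp_three_c309123c1_of_noThreeTorsion hGZK hmod hCassels hr h0 hq hv).2 hq1 (n := 2)
    (by exact_mod_cast hv1)
  simpa using h

/-- The same number from p403480's `Sel₃`-shape record (`hSel : #Sel^{(3)}(c2) ∣ 3`), isogeny
discharged. PER CLASS. [cite: Miller2011LMS, §1 and Def. 1.1] -/
theorem card_sha_three_c309123c1_of_selmer (hGZK : rank_eq_analyticRank_of_analyticRank_le_one)
    (hmod : hasEntireLFunction_rat) (hCassels : bsdRHS_eq_of_isIsogenous)
    (hr : Records.c309123c2.analyticRank = 1)
    {q : ℚ} (hq : shaAn Records.c309123c2 = (q : ℂ)) (hv : padicValRat 3 q = 0)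
    (hSel : Nat.card (Records.c309123c2.selmerGroup ((3 : ℕ) : ℤ)) ∣ 3)
    {q₁ : ℚ} (hq1 : shaAn Records.c309123c1 = (q₁ : ℂ)) (hv1 : padicValRat 3 q₁ = 2) :
    Nat.card (AddCommGroup.primaryComponent Records.c309123c1.sha 3) = 9 := by
  haveI : Fact (Nat.Prime 3) := ⟨Nat.prime_three⟩
  have h := JZeroThree.card_primaryComponent_eq_pow_of_bsdp Records.c309123c1 3
    (bsdp_three_c309123c1_of_selmer hGZK hmod hCassels hr hq hv hSel) hq1 (n := 2)
    (by exact_mod_cast hv1)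
  simpa using h

/-- **`#Ш(309123d1/ℚ)[3^∞] = 9` EXACTLY**: `BSD(d1, 3)` (`bsdp_three_c309123d1_of_noThreeTorsion`, from
the Cassels–Tate / second-descent certificate on `d2`) and `#Ш_an(d1) = q₁`, `ord₃ q₁ = 2` (`hq1`,
`hv1`; Cremona `9`). PER CLASS; nothing asserted. [cite: Miller2011LMS, §1 and Def. 1.1]
[cite: CreutzMiller2012, Rem. 2.4] [cite: Cremona1997, Table 1 (class 309123d)] -/
theorem card_sha_three_c309123d1 (hGZK : rank_eq_analyticRank_of_analyticRank_le_one)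
    (hmod : hasEntireLFunction_rat) (hCassels : bsdRHS_eq_of_isIsogenous)
    (hr : Records.c309123d2.analyticRank = 1)
    (h0 : ∀ x : ↥Records.c309123d2.sha, 3 • x = 0 → x = 0)
    {q : ℚ} (hq : shaAn Records.c309123d2 = (q : ℂ)) (hv : padicValRat 3 q = 0)
    {q₁ : ℚ} (hq1 : shaAn Records.c309123d1 = (q₁ : ℂ)) (hv1 : padicValRat 3 q₁ = 2) :
    Nat.card (AddCommGroup.primaryComponent Records.c309123d1.sha 3) = 9 := by
  haveI : Fact (Nat.Prime 3) := ⟨Nat.prime_three⟩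
  have h := JZeroThree.card_primaryComponent_eq_pow_of_bsdp Records.c309123d1 3
    (bsdp_three_c309123d1_of_noThreeTorsion hGZK hmod hCassels hr h0 hq hv).2 hq1 (n := 2)
    (by exact_mod_cast hv1)
  simpa using h

/-- The same number from p403480's `Sel₃`-shape record shape at `d2` (`hSel` = the B-24 verdict),
isogeny discharged. PER CLASS. [cite: Miller2011LMS, §1 and Def. 1.1] -/
theorem card_sha_three_c309123d1_of_selmer (hGZK : rank_eq_analyticRank_of_analyticRank_le_one)
    (hmod : hasEntireLFunction_rat) (hCassels : bsdRHS_eq_of_isIsogenous)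
    (hr : Records.c309123d2.analyticRank = 1)
    {q : ℚ} (hq : shaAn Records.c309123d2 = (q : ℂ)) (hv : padicValRat 3 q = 0)
    (hSel : Nat.card (Records.c309123d2.selmerGroup ((3 : ℕ) : ℤ)) ∣ 3)
    {q₁ : ℚ} (hq1 : shaAn Records.c309123d1 = (q₁ : ℂ)) (hv1 : padicValRat 3 q₁ = 2) :
    Nat.card (AddCommGroup.primaryComponent Records.c309123d1.sha 3) = 9 := by
  haveI : Fact (Nat.Prime 3) := ⟨Nat.prime_three⟩
  have h := JZeroThree.card_primaryComponent_eq_pow_of_bsdp Records.c309123d1 3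
    (bsdp_three_c309123d1_of_selmer hGZK hmod hCassels hr hq hv hSel) hq1 (n := 2)
    (by exact_mod_cast hv1)
  simpa using h

/-- **`Ш(309123c1/ℚ)[3^∞] = Ш(309123c1/ℚ)[3] ≅ (ℤ/3ℤ)²`**: order `9` (`card_sha_three_c309123c1`) and
every element killed by `3`, under the further CERTIFICATE binder `h9` — `Ш(c1)[3]` has at least `9`
elements: `dim_𝔽₃ Ш(c1)[φ] = EXCESS(c1 — c2) − dim Ш(c2)[φ̂] = 2 − 0 = 2` (both engines, kit
j282241 / j282242; `Ш(c2)[φ̂] ⊆ Ш(c2)[3] = 0` by `h0`). PER CLASS; nothing asserted.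
[cite: SilvermanAEC2009, X.4 (descent via isogeny)] [cite: Miller2011LMS, §1 and Def. 1.1] -/
theorem sha_three_primary_eq_torsion_c309123c1
    (hGZK : rank_eq_analyticRank_of_analyticRank_le_one)
    (hmod : hasEntireLFunction_rat) (hCassels : bsdRHS_eq_of_isIsogenous)
    (hr : Records.c309123c2.analyticRank = 1)
    (h0 : ∀ x : ↥Records.c309123c2.sha, 3 • x = 0 → x = 0)
    {q : ℚ} (hq : shaAn Records.c309123c2 = (q : ℂ)) (hv : padicValRat 3 q = 0)
    {q₁ : ℚ} (hq1 : shaAn Records.c309123c1 = (q₁ : ℂ)) (hv1 : padicValRat 3 q₁ = 2)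
    (h9 : 9 ≤ Nat.card {x : ↥Records.c309123c1.sha // (3 : ℕ) • x = 0}) :
    Nat.card (AddCommGroup.primaryComponent Records.c309123c1.sha 3) = 9 ∧
      ∀ x : ↥Records.c309123c1.sha,
        x ∈ AddCommGroup.primaryComponent Records.c309123c1.sha 3 → (3 : ℕ) • x = 0 := by
  have hcard := card_sha_three_c309123c1 hGZK hmod hCassels hr h0 hq hv hq1 hv1
  haveI : Finite (AddCommGroup.primaryComponent Records.c309123c1.sha 3) :=
    (bsdp_three_c309123c1_of_noThreeTorsion hGZK hmod hCassels hr h0 hq hv).2.2.1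
  exact ⟨hcard, JZeroThree.primaryComponent_smul_eq_zero_of_card 3 (hcard ▸ h9)⟩

/-- **`Ш(309123d1/ℚ)[3^∞] = Ш(309123d1/ℚ)[3] ≅ (ℤ/3ℤ)²**: order `9` (`card_sha_three_c309123d1`) and
every element killed by `3`, under `h9` — `dim_𝔽₃ Ш(d1)[φ] = EXCESS(d1 — d2) − dim Ш(d2)[φ̂] =
2 − 0` (kit j282241 / j282242 for the EXCESS; `Ш(d2)[φ̂] ⊆ Ш(d2)[3] = 0` by `h0`). PER CLASS;
nothing asserted. [cite: SilvermanAEC2009, X.4 (descent via isogeny)] [cite: CreutzMiller2012, Rem. 2.4] -/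
theorem sha_three_primary_eq_torsion_c309123d1
    (hGZK : rank_eq_analyticRank_of_analyticRank_le_one)
    (hmod : hasEntireLFunction_rat) (hCassels : bsdRHS_eq_of_isIsogenous)
    (hr : Records.c309123d2.analyticRank = 1)
    (h0 : ∀ x : ↥Records.c309123d2.sha, 3 • x = 0 → x = 0)
    {q : ℚ} (hq : shaAn Records.c309123d2 = (q : ℂ)) (hv : padicValRat 3 q = 0)
    {q₁ : ℚ} (hq1 : shaAn Records.c309123d1 = (q₁ : ℂ)) (hv1 : padicValRat 3 q₁ = 2)
    (h9 : 9 ≤ Nat.card {x : ↥Records.c309123d1.sha // (3 : ℕ) • x = 0}) :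
    Nat.card (AddCommGroup.primaryComponent Records.c309123d1.sha 3) = 9 ∧
      ∀ x : ↥Records.c309123d1.sha,
        x ∈ AddCommGroup.primaryComponent Records.c309123d1.sha 3 → (3 : ℕ) • x = 0 := by
  have hcard := card_sha_three_c309123d1 hGZK hmod hCassels hr h0 hq hv hq1 hv1
  haveI : Finite (AddCommGroup.primaryComponent Records.c309123d1.sha 3) :=
    (bsdp_three_c309123d1_of_noThreeTorsion hGZK hmod hCassels hr h0 hq hv).2.2.1
  exact ⟨hcard, JZeroThree.primaryComponent_smul_eq_zero_of_card 3 (hcard ▸ h9)⟩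

end Summit.BirchSwinnertonDyer.Rank1Residual.X12

end
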